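import Summits.Ventures.YMGap.Thresholds.PressureTwoSided
import Summits.Ventures.YMGap.Thresholds.PressureSecondDerivative
import HarnessLib

/-!
# `C²` on the whole two-sided window `|β_W| < 9/25` of `SU(2)` and Wilson's normalisation (row type C-PRESS, part 8)

Cell `pub-ymgap`, seat ds-1 (gen 9). HONEST FRAMING: strong-coupling LATTICE statements for `SU(2)` Wilson lattice gauge theory on
`ℤ⁴`; `C²` regularity of the infinite-volume free energy density on the TWO-SIDED one-state window `|β| < 9/50` (tree coupling;
`|β_W| < 9/25`) — NOT analyticity; nothing about the continuum or the Clay problem. Kernel theorems only, 0 compute.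

* `su2_hasDerivAt_deriv_freeEnergyDensity_neg` — `(f')'(-β) = (f')'(β)` = the plaquette susceptibility at `β` (oddness law of part 7,
  `f'(-t) = -24 - f'(t)`, differentiated; part 2 at `β > 0`);
* ★★ `su2_contDiffOn_two_freeEnergyDensity_abs : ContDiffOn ℝ 2 (freeEnergyDensity 4 ρ_{SU(2)}) (Ioo (-9/50) (9/50))` — `f ∈ C²` on
  the WHOLE two-sided window, through `β = 0` (`(f')'(t)` = susceptibility at `|t|`, `= 6` at `t = 0` by part 7, continuous on the
  closed window): no first- or second-order transition anywhere in `|β_W| < 9/25`, as a statement about the thermodynamic potential;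
* Wilson normalisation `g(β_W) = f(β_W/2)` (`= lim L⁻⁴ log ∫ exp(-β_W Σ_p (1 - ½ Re tr U_p)) ∏ dU`): ★ `su2_wilson_contDiffOn_two`
  (`C²` on `|β_W| < 9/25`), `su2_wilson_hasDerivAt_zero` (`g'(0) = -6`), `su2_wilson_hasDerivAt_deriv_zero` (`g''(0) = 3/2`, i.e.
  `g(β_W) = -6β_W + (3/4)β_W² + o(β_W²)` — the Balian–Drouffe–Itzykson quadratic term, matching rb-p2's two-sided free-energy law).
-/

noncomputable section

open MeasureTheory ProbabilityTheory Set Filter Topology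
open scoped NNReal
open Literature.MathematicalPhysics.QuantumLattice (LGConfig ZdEdge ZdPlaquette fundamentalRep ymGibbsMeasures
  ymSpecification plaquetteObs plaquetteEdges freeEnergyDensity IsZdTranslationInvariant continuous_fundamentalRep)
open Literature.MathematicalPhysics.QuantumFieldTheory hiding ZdEdge

namespace Summit.Ventures.YMGap.PressureRegularity

/-! ## G. `C²` on the two-sided window and Wilson's normalisation -/

section TwoSidedC2

open Summit.Ventures.YMGap.CouplingResponse (su2_continuousOn_responseSum)

/-- Local shorthand: the planes `{(i, j) : i < j}` of `ℤ⁴`. -/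
local notation3 (prettyPrint := false) "𝔓₄" => {q : Fin 4 × Fin 4 // q.1 < q.2}

/-- **`f'` is differentiable at NEGATIVE couplings** `-β`, `0 < β < 9/50`, with `(f')'(-β) = (f')'(β)` = the plaquette
susceptibility at `β` (oddness law `f'(-t) = -24 - f'(t)` differentiated; part 2 at `β`). -/
theorem su2_hasDerivAt_deriv_freeEnergyDensity_neg
    {μ : ℝ → Measure (LGConfig 4 (Matrix.specialUnitaryGroup (Fin 2) ℂ))}
    (hμ : ∀ β ∈ Icc (0 : ℝ) (9 / 50), μ β ∈ ymGibbsMeasures (d := 4) (fundamentalRep (Fin 2)) β)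
    {β : ℝ} (hβ : β ∈ Ioo (0 : ℝ) (9 / 50)) :
    HasDerivAt (deriv (freeEnergyDensity 4 (fundamentalRep (Fin 2))))
      (∑ q : 𝔓₄, 4 * ∑' r : ZdPlaquette 4, cov[zdPlaquetteObs (fundamentalRep (Fin 2)) 0 q.1.1 q.1.2,
        zdPlaquetteObs (fundamentalRep (Fin 2)) r.1 r.2.1.1 r.2.1.2; μ β]) (-β) := by
  set S : ℝ := ∑ q : 𝔓₄, 4 * ∑' r : ZdPlaquette 4, cov[zdPlaquetteObs (fundamentalRep (Fin 2)) 0 q.1.1 q.1.2,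
    zdPlaquetteObs (fundamentalRep (Fin 2)) r.1 r.2.1.1 r.2.1.2; μ β] with hS
  have hpos := su2_hasDerivAt_deriv_freeEnergyDensity hμ hβ
  -- `deriv f t = -24 - deriv f (-t)` near `-β`
  have hev : deriv (freeEnergyDensity 4 (fundamentalRep (Fin 2))) =ᶠ[𝓝 (-β)]
      fun t => -24 - deriv (freeEnergyDensity 4 (fundamentalRep (Fin 2))) (-t) := by
    filter_upwards [Ioo_mem_nhds (show (-(9 / 50) : ℝ) < -β by linarith [hβ.2]) (show -β < (9 / 50 : ℝ) by linarith [hβ.1])]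
      with t ht
    have h := su2_deriv_freeEnergyDensity_neg (β := -t) ⟨by linarith [ht.2], by linarith [ht.1]⟩
    rw [neg_neg] at h
    exact h
  have hinner : HasDerivAt (fun t : ℝ => -t) (-1 : ℝ) (-β) := by simpa using hasDerivAt_neg (-β)
  have hpos' : HasDerivAt (deriv (freeEnergyDensity 4 (fundamentalRep (Fin 2)))) S ((fun t : ℝ => -t) (-β)) := by
    rw [show (fun t : ℝ => -t) (-β) = β by simp]; exact hpos
  have hcomp := HasDerivAt.comp (-β) hpos' hinner
  have h2 : HasDerivAt (fun t => -24 - deriv (freeEnergyDensity 4 (fundamentalRep (Fin 2))) (-t)) S (-β) := by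
    have := hcomp.const_sub (-24 : ℝ)
    simpa [Function.comp_def] using this
  exact h2.congr_of_eventuallyEq hev

/-- ★★ **`f ∈ C²` ON THE WHOLE TWO-SIDED WINDOW `(-9/50, 9/50)`** (`|β_W| < 9/25`), through `β = 0`:
`ContDiffOn ℝ 2 (freeEnergyDensity 4 ρ_{SU(2)}) (Ioo (-9/50) (9/50))` — `(f')'(β)` is the plaquette susceptibility at `|β|`
(parts 2, 7), continuous on the closed window. No first- or second-order transition anywhere in `|β_W| < 9/25`. -/
theorem su2_contDiffOn_two_freeEnergyDensity_abs :
    ContDiffOn ℝ 2 (freeEnergyDensity 4 (fundamentalRep (Fin 2))) (Ioo (-(9 / 50) : ℝ) (9 / 50)) := by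
  classical
  obtain ⟨μ, hμ⟩ := CouplingResponse.exists_dlrSelection
  have hμW : ∀ βW ∈ Icc (0 : ℝ) (9 / 25), μ βW ∈ ymGibbsMeasures (d := 4) (fundamentalRep (Fin 2)) (2 * (βW / 4)) :=
    fun βW _ => hμ βW
  set ν : ℝ → Measure (LGConfig 4 (Matrix.specialUnitaryGroup (Fin 2) ℂ)) := fun β => μ (2 * β) with hν
  have hνsel : ∀ t ∈ Icc (0 : ℝ) (9 / 50), ν t ∈ ymGibbsMeasures (d := 4) (fundamentalRep (Fin 2)) t := fun t _ => by
    have h := hμ (2 * t)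
    rwa [show (2 : ℝ) * (2 * t / 4) = t by ring] at h
  -- the susceptibility of THE state at `|t|`
  set S : ℝ → ℝ := fun t => ∑ q : 𝔓₄, 4 * ∑' r : ZdPlaquette 4,
    cov[zdPlaquetteObs (fundamentalRep (Fin 2)) 0 q.1.1 q.1.2,
      zdPlaquetteObs (fundamentalRep (Fin 2)) r.1 r.2.1.1 r.2.1.2; ν t] with hS
  have hS0 : S 0 = 6 := by
    have h0 : ν 0 ∈ ymGibbsMeasures (d := 4) (fundamentalRep (Fin 2)) 0 := hνsel 0 ⟨le_rfl, by norm_num⟩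
    simp only [hS]
    rw [Finset.sum_congr rfl fun q _ => by
        rw [su2_responseSum_zero h0 ((0 : Literature.Probability.LatticeModels.Site 4), q)],
      Finset.sum_const, Finset.card_univ, nsmul_eq_mul]
    have hcard : (Fintype.card 𝔓₄ : ℝ) = 6 := by
      rw [Fintype.card_subtype]; norm_cast
    rw [hcard]; norm_num
  have hderiv2 : ∀ t ∈ Ioo (-(9 / 50) : ℝ) (9 / 50),
      HasDerivAt (deriv (freeEnergyDensity 4 (fundamentalRep (Fin 2)))) (S |t|) t := by
    intro t ht
    rcases lt_trichotomy t 0 with hneg | rfl | hpos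
    · have h := su2_hasDerivAt_deriv_freeEnergyDensity_neg hνsel (β := -t) ⟨by linarith, by linarith [ht.1]⟩
      rw [neg_neg] at h
      simp only [hS, abs_of_neg hneg]
      exact h
    · rw [abs_zero, hS0]; exact su2_hasDerivAt_deriv_freeEnergyDensity_zero
    · simp only [hS, abs_of_pos hpos]
      exact su2_hasDerivAt_deriv_freeEnergyDensity hνsel ⟨hpos, ht.2⟩
  have hScont : ContinuousOn (fun t => S |t|) (Icc (-(9 / 50) : ℝ) (9 / 50)) :=
    (su2_continuousOn_susceptibility hνsel).comp continuous_abs.continuousOn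
      fun t ht => ⟨abs_nonneg t, abs_le.2 ⟨by linarith [ht.1], ht.2⟩⟩
  rw [show (2 : WithTop ℕ∞) = 1 + 1 from rfl, contDiffOn_succ_iff_deriv_of_isOpen isOpen_Ioo]
  refine ⟨su2_differentiableOn_freeEnergyDensity_abs, fun h => absurd h (by simp), ?_⟩
  exact CouplingResponse.contDiffOn_one_of_hasDerivAt hderiv2 hScont


/-- ★★ **Wilson normalisation, two-sided**: `g(β_W) := f(β_W/2)` (`= lim L⁻⁴ log ∫ exp(-β_W Σ_p (1 - ½ Re tr U_p))`) is `C²` on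
`|β_W| < 9/25`, with `g'(0) = -6` and `g''(0) = 3/2`. -/
theorem su2_wilson_contDiffOn_two :
    ContDiffOn ℝ 2 (fun βW : ℝ => freeEnergyDensity 4 (fundamentalRep (Fin 2)) (βW / 2)) (Ioo (-(9 / 25) : ℝ) (9 / 25)) :=
  su2_contDiffOn_two_freeEnergyDensity_abs.comp (contDiff_id.div_const (2 : ℝ)).contDiffOn
    fun b hb => ⟨by linarith [hb.1], by linarith [hb.2]⟩

/-- `g'(0) = -6` (two-sided). -/
theorem su2_wilson_hasDerivAt_zero :
    HasDerivAt (fun βW : ℝ => freeEnergyDensity 4 (fundamentalRep (Fin 2)) (βW / 2)) (-6 : ℝ) 0 := by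
  have h := su2_hasDerivAt_freeEnergyDensity_zero
  have hinner : HasDerivAt (fun βW : ℝ => βW / 2) (1 / 2 : ℝ) 0 := by
    simpa using (hasDerivAt_id (0 : ℝ)).div_const (2 : ℝ)
  have h0 : HasDerivAt (freeEnergyDensity 4 (fundamentalRep (Fin 2))) (-12 : ℝ) ((fun βW : ℝ => βW / 2) 0) := by
    rw [show (fun βW : ℝ => βW / 2) 0 = 0 by norm_num]; exact h
  have hc := HasDerivAt.comp (0 : ℝ) h0 hinner
  refine hc.congr_deriv ?_
  norm_num

/-- `g''(0) = 3/2` (two-sided): `deriv g = ½ f'(·/2)` near `0` and `(f')'(0) = 6`. -/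
theorem su2_wilson_hasDerivAt_deriv_zero :
    HasDerivAt (deriv fun βW : ℝ => freeEnergyDensity 4 (fundamentalRep (Fin 2)) (βW / 2)) (3 / 2 : ℝ) 0 := by
  obtain ⟨ν, hν⟩ := su2_exists_dlrSelection_tree
  -- `deriv g (s) = ½ · deriv f (s/2)` on the open window
  have hev : (deriv fun βW : ℝ => freeEnergyDensity 4 (fundamentalRep (Fin 2)) (βW / 2)) =ᶠ[𝓝 0]
      fun s => (1 / 2 : ℝ) * deriv (freeEnergyDensity 4 (fundamentalRep (Fin 2))) (s / 2) := by
    filter_upwards [Ioo_mem_nhds (show (-(9 / 25) : ℝ) < 0 by norm_num) (show (0 : ℝ) < 9 / 25 by norm_num)] with s hs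
    have hs' : s / 2 ∈ Ioo (-(9 / 50) : ℝ) (9 / 50) := ⟨by linarith [hs.1], by linarith [hs.2]⟩
    have hf := su2_hasDerivAt_freeEnergyDensity_abs (fun b _ => hν b) hs'
    have hinner : HasDerivAt (fun βW : ℝ => βW / 2) (1 / 2 : ℝ) s := by
      simpa using (hasDerivAt_id s).div_const (2 : ℝ)
    have hc := HasDerivAt.comp s hf hinner
    rw [show (freeEnergyDensity 4 (fundamentalRep (Fin 2)) ∘ fun βW : ℝ => βW / 2) =
      fun βW : ℝ => freeEnergyDensity 4 (fundamentalRep (Fin 2)) (βW / 2) from rfl] at hc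
    rw [hc.deriv, hf.deriv]
    ring
  have hinner : HasDerivAt (fun s : ℝ => s / 2) (1 / 2 : ℝ) 0 := by
    simpa using (hasDerivAt_id (0 : ℝ)).div_const (2 : ℝ)
  have h2 : HasDerivAt (deriv (freeEnergyDensity 4 (fundamentalRep (Fin 2)))) (6 : ℝ) ((fun s : ℝ => s / 2) 0) := by
    rw [show (fun s : ℝ => s / 2) 0 = 0 by norm_num]; exact su2_hasDerivAt_deriv_freeEnergyDensity_zero
  have hc := (HasDerivAt.comp (0 : ℝ) h2 hinner).const_mul (1 / 2 : ℝ)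
  refine (hc.congr_of_eventuallyEq hev).congr_deriv ?_
  norm_num

end TwoSidedC2

end Summit.Ventures.YMGap.PressureRegularity

end
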